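import Literature.IUT.LogVolume.LocalFieldTraceRetraction
import Literature.IUT.LogVolume.WildCubicIsometryMover
import HarnessLib

/-!
# Ascent of maximal-order movers along field extensions: orthogonal complements over `ℚ_p`,
# extension of isometries, and injectivity / integrality-reflection of packet morphisms

Classical non-archimedean functional analysis and local algebra (nothing disputed; the [IUTchIV] locator records
where the abc-iut cell uses it).  [IUTchIV] Prop. 1.1 p. 9 attaches to a tensor packet `V = ⊗_{ℚ_p} k_i` the
maximal `ℤ_p`-order `(R_I)^∼` (the tree's `normalizedPacket` = integral closure of `ℤ_p` in `V`, abc-iut-S5's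
`mem_normalizedPacket_iff_isIntegral`).  A factorwise `ℚ_p`-linear ISOMETRY `g_i` of `k_i` may MOVE `(R_I)^∼`
(`(⊗ g_i)((R_I)^∼) ≠ (R_I)^∼`): explicit exhibits exist over the fields `ℚ₃(∛3)` (`WildCubicIsometryMover`) and
`ℚ₂(√2)` (`WildQuadraticIsometryMover`).  THIS FILE proves that such exhibits ASCEND along field embeddings
`σ_i : k_i → k'_i`: every mover over the small fields yields a mover over the big fields, by isometries `G_i` of
`k'_i` EXTENDING the `g_i` (`G_i ∘ σ_i = σ_i ∘ g_i`).  Ingredients: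

* §1 (`MoverAscent.*`, any finite-dimensional ultrametric normed `ℚ_p`-space `E`): **orthogonal complements** —
  every subspace `S ⊆ E` has a complement `T` with `‖s + t‖ = max(‖s‖, ‖t‖)` (`exists_orthogonal_compl`; best
  approximation in the closed `S` inside the proper `E`, "all triangles are isosceles", induction on the
  codimension — the argument of Weil's *Basic Number Theory* Ch. II §1 for norms over a `p`-field); hence
  **isometries extend**: for an isometric `ℚ_p`-linear `i : E' → E` and an isometry `g` of `E'` there is an isometry
  `G` of `E` with `G ∘ i = i ∘ g` (`exists_isometry_extension`: `G = g ⊕ id` on `i(E') ⊕ T`);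
* §2 (packets, the tree's `PacketAlgebra` / `iota` / `normalizedPacket`): along `ℚ_p`-algebra maps of fields
  `σ_i : k_i → k'_i`, a packet morphism `φ` with `φ(ι_i a) = ι'_i(σ_i a)` (it exists: abc-iut-w5-d036's
  `exists_packetAlgHom_of_algHom`) INTERTWINES `⊗ g_i` with `⊗ G_i` whenever `G_i ∘ σ_i = σ_i ∘ g_i`
  (`map_congr_eq_congr_map`), is INJECTIVE (`exists_leftInverse_packetAlgHom`: slotwise `ℚ_p`-linear retractions), and
  therefore REFLECTS the maximal order: `φ x ∈ (R'_I)^∼ ↔ x ∈ (R_I)^∼` (`map_mem_normalizedPacket_iff`; the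
  forward half is w5-d036's `map_mem_normalizedPacket`);
* §3 **ASCENT** (`exists_isometries_mover_of_mover`): if `z ∈ (R_I)^∼` and `(⊗ g_i) z ∉ (R_I)^∼` for factorwise
  isometries `g_i` of the `k_i`, then for isometries `G_i` of the `k'_i` extending the `g_i` (they exist, §1,
  field embeddings being isometric — w5's `norm_map_algHom`) `φ z ∈ (R'_I)^∼` and `(⊗ G_i)(φ z) ∉ (R'_I)^∼`;
  `exists_isometry_mover_pair_of_subfield` — the two-slot `![G, 1]` form in the exact shape of
  `WildCubicIsometryMover.exists_isometry_maxOrder_mover` (slot `1` stays the identity).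

Use (abc-iut cell, R-J row Y-29b, rider R2 of the block-E adversary lane): a maximal-order mover exhibited over ONE
field `k₀` (e.g. `ℚ₃(∛3)`, `ℚ₂(√2)`, `ℚ₂(ζ₁₂)`) bites EVERY `p`-adic field `K ⊇ k₀`; the degree binders
(`finrank ℚ_p K = 3`, `= 2`) of the instance theorems are not needed.  Statement about CONTAINERS only; it takes no
side on [IUTchIII] Cor. 3.12.  PROOF-ONLY file (theorems, no definitions, no `Prop` facts).
[cite: WeilBNT1967, Ch. II §1, Prop. 2–3 (orthogonal decompositions for norms over p-fields)]
[cite: NeukirchANT1999, Ch. II Thm. (4.8)] [cite: Mochizuki2012, IUTchIV Prop. 1.1 p. 9]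
-/

noncomputable section

open Metric Set Module
open scoped TensorProduct

namespace Literature.IUT.LogVolume

/-! ## §1 Orthogonal complements and extension of isometries over `ℚ_p` -/

namespace MoverAscent

section Scaling

variable {p : ℕ} [Fact p.Prime]
variable {E : Type*} [NormedAddCommGroup E] [NormedSpace ℚ_[p] E]

/-- If `w` is orthogonal to the subspace `S` (`‖s + w‖ = max(‖s‖, ‖w‖)` for `s ∈ S`), then so is every multiple
`a • w`: `‖s + a•w‖ = max(‖s‖, ‖a•w‖)` (factor out `a`). [cite: WeilBNT1967, Ch. II §1, Prop. 2–3] -/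
theorem norm_add_smul_eq_max {S : Submodule ℚ_[p] E} {w : E} (hw : ∀ s ∈ S, ‖s + w‖ = max ‖s‖ ‖w‖)
    {s : E} (hs : s ∈ S) (a : ℚ_[p]) : ‖s + a • w‖ = max ‖s‖ ‖a • w‖ := by
  by_cases ha : a = 0
  · rw [ha, zero_smul, add_zero, norm_zero, max_eq_left (norm_nonneg _)]
  · have h : s + a • w = a • (a⁻¹ • s + w) := by
      rw [smul_add, smul_smul, mul_inv_cancel₀ ha, one_smul]
    rw [h, norm_smul, hw _ (S.smul_mem _ hs), mul_max_of_nonneg _ _ (norm_nonneg a), ← norm_smul,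
      smul_smul, mul_inv_cancel₀ ha, one_smul, norm_smul]

end Scaling

section Orthogonal

variable {p : ℕ} [Fact p.Prime]
variable {E : Type*} [NormedAddCommGroup E] [NormedSpace ℚ_[p] E] [IsUltrametricDist E]
  [FiniteDimensional ℚ_[p] E]

/-- **Best approximation gives an orthogonal vector.**  For a proper subspace `S ⊊ E` of a finite-dimensional
ultrametric normed `ℚ_p`-space there is `w ∉ S` with `‖s + w‖ = max(‖s‖, ‖w‖)` for all `s ∈ S`: take `x ∉ S`, a
nearest point `y ∈ S` (`S` is closed, `E` is proper over the locally compact `ℚ_p`), `w = x − y`; then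
`‖w‖ ≤ ‖s + w‖` for `s ∈ S`, and all triangles are isosceles. [cite: WeilBNT1967, Ch. II §1, Prop. 2–3] -/
theorem exists_orthogonal_of_ne_top (S : Submodule ℚ_[p] E) (hS : S ≠ ⊤) :
    ∃ w : E, w ∉ S ∧ ∀ s ∈ S, ‖s + w‖ = max ‖s‖ ‖w‖ := by
  haveI : ProperSpace E := FiniteDimensional.proper ℚ_[p] E
  obtain ⟨x, -, hx⟩ := SetLike.exists_of_lt (lt_top_iff_ne_top.mpr hS)
  have hcl : IsClosed (S : Set E) := S.closed_of_finiteDimensional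
  obtain ⟨y, hyS, hy⟩ := hcl.exists_infDist_eq_dist ⟨0, S.zero_mem⟩ x
  refine ⟨x - y, fun h => hx ?_, fun s hs => ?_⟩
  · rw [← sub_add_cancel x y]
    exact S.add_mem h hyS
  · have hle : ‖x - y‖ ≤ ‖s + (x - y)‖ := by
      have h1 : infDist x (S : Set E) ≤ dist x (y - s) := infDist_le_dist_of_mem (S.sub_mem hyS hs)
      rw [hy, dist_eq_norm, dist_eq_norm] at h1
      have h2 : x - (y - s) = s + (x - y) := by abel
      rwa [h2] at h1
    by_cases hne : ‖s‖ = ‖x - y‖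
    · refine le_antisymm (IsUltrametricDist.norm_add_le_max _ _) ?_
      rw [hne, max_self]
      exact hle
    · exact IsUltrametricDist.norm_add_eq_max_of_norm_ne_norm hne

/-- **Orthogonal complements exist** in a finite-dimensional ultrametric normed `ℚ_p`-space: every subspace `S`
has a linear complement `T` with `‖s + t‖ = max(‖s‖, ‖t‖)` for `s ∈ S`, `t ∈ T` (induction on the codimension:
adjoin an orthogonal vector `w`, `S ⊕ ℚ_p w`, and put `T = ℚ_p w ⊕ T₁`). [cite: WeilBNT1967, Ch. II §1, Prop. 2–3] -/
theorem exists_orthogonal_compl (S : Submodule ℚ_[p] E) :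
    ∃ T : Submodule ℚ_[p] E, IsCompl S T ∧ ∀ s ∈ S, ∀ t ∈ T, ‖s + t‖ = max ‖s‖ ‖t‖ := by
  suffices h : ∀ (n : ℕ) (S : Submodule ℚ_[p] E), finrank ℚ_[p] S + n = finrank ℚ_[p] E →
      ∃ T : Submodule ℚ_[p] E, IsCompl S T ∧ ∀ s ∈ S, ∀ t ∈ T, ‖s + t‖ = max ‖s‖ ‖t‖ from
    h (finrank ℚ_[p] E - finrank ℚ_[p] S) S (Nat.add_sub_cancel' (Submodule.finrank_le S))
  intro n
  induction n with
  | zero =>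
    intro S hS
    rw [add_zero] at hS
    have htop : S = ⊤ := Submodule.eq_top_of_finrank_eq hS
    refine ⟨⊥, by rw [htop]; exact isCompl_top_bot, fun s _ t ht => ?_⟩
    rw [(Submodule.mem_bot ℚ_[p]).mp ht, add_zero, norm_zero, max_eq_left (norm_nonneg _)]
  | succ n ih =>
    intro S hS
    have hne : S ≠ ⊤ := by
      intro h
      rw [h, finrank_top] at hS
      omega
    obtain ⟨w, hwS, hw⟩ := exists_orthogonal_of_ne_top S hne
    have hw0 : w ≠ 0 := fun h => hwS (h ▸ S.zero_mem)
    have hdisj : Disjoint S (ℚ_[p] ∙ w) := (Submodule.disjoint_span_singleton' hw0).mpr hwS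
    have hwmem : ∀ a : ℚ_[p], a • w ∈ S ⊔ (ℚ_[p] ∙ w) := fun a =>
      Submodule.mem_sup_right (Submodule.smul_mem _ a (Submodule.mem_span_singleton_self w))
    have hrank : finrank ℚ_[p] ↥(S ⊔ (ℚ_[p] ∙ w)) + n = finrank ℚ_[p] E := by
      have h1 := Submodule.finrank_sup_add_finrank_inf_eq S (ℚ_[p] ∙ w)
      rw [hdisj.eq_bot, finrank_bot, add_zero, finrank_span_singleton hw0] at h1
      omega
    obtain ⟨T₁, hc₁, hT₁⟩ := ih (S ⊔ (ℚ_[p] ∙ w)) hrank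
    refine ⟨(ℚ_[p] ∙ w) ⊔ T₁, IsCompl.of_eq ?_ ?_, ?_⟩
    · rw [Submodule.eq_bot_iff]
      intro x hx
      obtain ⟨hxS, hxT⟩ := Submodule.mem_inf.mp hx
      obtain ⟨y, hy, t, ht, hyt⟩ := Submodule.mem_sup.mp hxT
      obtain ⟨a, rfl⟩ := Submodule.mem_span_singleton.mp hy
      have htS₁ : t ∈ S ⊔ (ℚ_[p] ∙ w) := by
        have h2 : t = x - a • w := by rw [← hyt]; abel
        rw [h2]
        exact Submodule.sub_mem _ (Submodule.mem_sup_left hxS) (hwmem a)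
      have ht0 : t = 0 := (Submodule.disjoint_def.mp hc₁.disjoint) t htS₁ ht
      rw [ht0, add_zero] at hyt
      have hawS : a • w ∈ S := hyt ▸ hxS
      have haw0 : a • w = 0 := (Submodule.disjoint_def.mp hdisj) _ hawS
        (Submodule.smul_mem _ a (Submodule.mem_span_singleton_self w))
      rw [← hyt, haw0]
    · rw [← sup_assoc]
      exact hc₁.sup_eq_top
    · intro s hs t ht
      obtain ⟨y, hy, t₁, ht₁, rfl⟩ := Submodule.mem_sup.mp ht
      obtain ⟨a, rfl⟩ := Submodule.mem_span_singleton.mp hy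
      have hs₁ : s + a • w ∈ S ⊔ (ℚ_[p] ∙ w) := Submodule.add_mem _ (Submodule.mem_sup_left hs) (hwmem a)
      rw [← add_assoc, hT₁ _ hs₁ _ ht₁, norm_add_smul_eq_max hw hs a, hT₁ _ (hwmem a) _ ht₁, max_assoc]

variable {E' : Type*} [NormedAddCommGroup E'] [NormedSpace ℚ_[p] E']

/-- **Isometries extend along isometric embeddings.**  For an isometric `ℚ_p`-linear `i : E' → E` into a
finite-dimensional ultrametric normed `ℚ_p`-space and a `ℚ_p`-linear isometry `g` of `E'`, there is a `ℚ_p`-linear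
isometry `G` of `E` with `G ∘ i = i ∘ g`: on an orthogonal decomposition `E = i(E') ⊕ T` put `G := g ⊕ id`, i.e.
`G = id + i ∘ (g − id) ∘ π` for the projection `π : E → E'` along `T`. [cite: WeilBNT1967, Ch. II §1, Prop. 2–3] -/
theorem exists_isometry_extension (i : E' →ₗ[ℚ_[p]] E) (hi : ∀ x, ‖i x‖ = ‖x‖) (g : E' ≃ₗ[ℚ_[p]] E')
    (hg : ∀ x, ‖g x‖ = ‖x‖) :
    ∃ G : E ≃ₗ[ℚ_[p]] E, (∀ x, G (i x) = i (g x)) ∧ ∀ y, ‖G y‖ = ‖y‖ := by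
  have hinj : Function.Injective i := by
    intro a b hab
    have h : ‖i (a - b)‖ = 0 := by rw [map_sub, hab, sub_self, norm_zero]
    rw [hi, norm_eq_zero, sub_eq_zero] at h
    exact h
  obtain ⟨T, hc, hT⟩ := exists_orthogonal_compl (LinearMap.range i)
  let π : E →ₗ[ℚ_[p]] E' := LinearMap.linearProjOfIsCompl T i hinj hc
  have hπi : ∀ x, π (i x) = x := fun x => LinearMap.linearProjOfIsCompl_apply_left T i hinj hc x
  have hπT : ∀ t ∈ T, π t = 0 := fun t ht => LinearMap.linearProjOfIsCompl_apply_right' T i hinj hc t ht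
  have hdec : ∀ y : E, ∃ (x : E') (t : E), t ∈ T ∧ y = i x + t := by
    intro y
    have hy : y ∈ LinearMap.range i ⊔ T := by
      rw [hc.sup_eq_top]
      exact Submodule.mem_top
    obtain ⟨u, hu, t, ht, rfl⟩ := Submodule.mem_sup.mp hy
    obtain ⟨x, rfl⟩ := LinearMap.mem_range.mp hu
    exact ⟨x, t, ht, rfl⟩
  let Gf : E →ₗ[ℚ_[p]] E := LinearMap.id + i ∘ₗ (g.toLinearMap - LinearMap.id) ∘ₗ π
  let Gb : E →ₗ[ℚ_[p]] E := LinearMap.id + i ∘ₗ (g.symm.toLinearMap - LinearMap.id) ∘ₗ π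
  have hπ : ∀ (x : E') (t : E), t ∈ T → π (i x + t) = x := fun x t ht => by
    rw [map_add, hπi, hπT t ht, add_zero]
  have hGf : ∀ (x : E') (t : E), t ∈ T → Gf (i x + t) = i (g x) + t := by
    intro x t ht
    show (i x + t) + i ((g.toLinearMap - LinearMap.id : E' →ₗ[ℚ_[p]] E') (π (i x + t))) = i (g x) + t
    rw [hπ x t ht, LinearMap.sub_apply, LinearMap.id_apply, LinearEquiv.coe_coe, map_sub]
    abel
  have hGb : ∀ (x : E') (t : E), t ∈ T → Gb (i x + t) = i (g.symm x) + t := by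
    intro x t ht
    show (i x + t) + i ((g.symm.toLinearMap - LinearMap.id : E' →ₗ[ℚ_[p]] E') (π (i x + t))) = i (g.symm x) + t
    rw [hπ x t ht, LinearMap.sub_apply, LinearMap.id_apply, LinearEquiv.coe_coe, map_sub]
    abel
  have h1 : Gf ∘ₗ Gb = LinearMap.id := by
    refine LinearMap.ext fun y => ?_
    obtain ⟨x, t, ht, rfl⟩ := hdec y
    rw [LinearMap.comp_apply, hGb x t ht, hGf _ t ht, LinearEquiv.apply_symm_apply, LinearMap.id_apply]
  have h2 : Gb ∘ₗ Gf = LinearMap.id := by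
    refine LinearMap.ext fun y => ?_
    obtain ⟨x, t, ht, rfl⟩ := hdec y
    rw [LinearMap.comp_apply, hGf x t ht, hGb _ t ht, LinearEquiv.symm_apply_apply, LinearMap.id_apply]
  refine ⟨LinearEquiv.ofLinear Gf Gb h1 h2, fun x => ?_, fun y => ?_⟩
  · have h := hGf x 0 T.zero_mem
    rw [add_zero, add_zero] at h
    exact h
  · obtain ⟨x, t, ht, rfl⟩ := hdec y
    rw [LinearEquiv.ofLinear_apply, hGf x t ht, hT _ (LinearMap.mem_range_self i _) t ht,
      hT _ (LinearMap.mem_range_self i _) t ht, hi, hi, hg]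

end Orthogonal

end MoverAscent

/-! ## §2 Packet morphisms along field maps: intertwining, injectivity, reflection of `(R_I)^∼` -/

section Packets

variable (p : ℕ) [Fact p.Prime]
variable {I : Type} [Fintype I] [DecidableEq I]
variable (k : I → Type) [∀ i, NontriviallyNormedField (k i)] [∀ i, NormedAlgebra ℚ_[p] (k i)]
variable (k' : I → Type) [∀ i, NontriviallyNormedField (k' i)] [∀ i, NormedAlgebra ℚ_[p] (k' i)]
variable (φ : PacketAlgebra p k →ₐ[ℚ_[p]] PacketAlgebra p k')
variable (σ : ∀ i, k i →ₐ[ℚ_[p]] k' i) (hφ : ∀ (i : I) (a : k i), φ (iota p k i a) = iota p k' i (σ i a))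
include hφ

/-- **Intertwining.**  If `G_i ∘ σ_i = σ_i ∘ g_i` slotwise, then `φ ∘ (⊗ g_i) = (⊗ G_i) ∘ φ` on the packets (check on
pure tensors: `φ(⊗ g_i x_i) = ⊗ σ_i(g_i x_i) = ⊗ G_i(σ_i x_i)`). [cite: Mochizuki2012, IUTchIV Prop. 1.1 p. 9] -/
theorem map_congr_eq_congr_map (g : ∀ i, k i ≃ₗ[ℚ_[p]] k i) (G : ∀ i, k' i ≃ₗ[ℚ_[p]] k' i)
    (hG : ∀ i a, G i (σ i a) = σ i (g i a)) (x : PacketAlgebra p k) :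
    φ (PiTensorProduct.congr g x) = PiTensorProduct.congr G (φ x) := by
  have hφ' : ∀ y : Π i, k i, φ (PiTensorProduct.tprod ℚ_[p] y) =
      PiTensorProduct.tprod ℚ_[p] (fun i => σ i (y i)) := map_purePacket_of_iota p k k' φ σ hφ
  have h : φ.toLinearMap ∘ₗ (PiTensorProduct.congr g).toLinearMap =
      (PiTensorProduct.congr G).toLinearMap ∘ₗ φ.toLinearMap := by
    refine PiTensorProduct.ext ?_
    refine MultilinearMap.ext fun y => ?_
    simp only [LinearMap.compMultilinearMap_apply, LinearMap.coe_comp, Function.comp_apply,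
      LinearEquiv.coe_coe, AlgHom.toLinearMap_apply, PiTensorProduct.congr_tprod]
    rw [hφ', hφ', PiTensorProduct.congr_tprod]
    congr 1
    funext i
    exact (hG i (y i)).symm
  exact LinearMap.congr_fun h x

/-- **A packet morphism along field maps has a `ℚ_p`-linear retraction** (hence is injective): each `σ_i` is an
injective `ℚ_p`-linear map of vector spaces, so it has a `ℚ_p`-linear retraction `r_i`, and `(⊗ r_i) ∘ φ = id`.
[cite: Mochizuki2012, IUTchIV Prop. 1.1 p. 9] -/
theorem exists_leftInverse_packetAlgHom :
    ∃ r : PacketAlgebra p k' →ₗ[ℚ_[p]] PacketAlgebra p k, ∀ x, r (φ x) = x := by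
  have hφ' : ∀ y : Π i, k i, φ (PiTensorProduct.tprod ℚ_[p] y) =
      PiTensorProduct.tprod ℚ_[p] (fun i => σ i (y i)) := map_purePacket_of_iota p k k' φ σ hφ
  have hr : ∀ i, ∃ r : k' i →ₗ[ℚ_[p]] k i, r ∘ₗ (σ i).toLinearMap = LinearMap.id := fun i =>
    LinearMap.exists_leftInverse_of_injective _ (LinearMap.ker_eq_bot.mpr (σ i).toRingHom.injective)
  choose r hr using hr
  refine ⟨PiTensorProduct.map r, fun x => ?_⟩
  have h : PiTensorProduct.map r ∘ₗ φ.toLinearMap = LinearMap.id := by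
    refine PiTensorProduct.ext ?_
    refine MultilinearMap.ext fun y => ?_
    simp only [LinearMap.compMultilinearMap_apply, LinearMap.coe_comp, Function.comp_apply,
      AlgHom.toLinearMap_apply, LinearMap.id_apply]
    rw [hφ', PiTensorProduct.map_tprod]
    congr 1
    funext i
    exact LinearMap.congr_fun (hr i) (y i)
  exact LinearMap.congr_fun h x

variable [Nonempty I] [∀ i, IsUltrametricDist (k i)] [∀ i, ProperSpace (k i)]
  [∀ i, IsUltrametricDist (k' i)] [∀ i, ProperSpace (k' i)]

/-- **`φ` reflects the maximal order**: `φ x ∈ (R'_I)^∼ ⟹ x ∈ (R_I)^∼` (integrality over `ℤ_p` is reflected by the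
injective algebra map `φ`). [cite: Mochizuki2012, IUTchIV Prop. 1.1 p. 9] -/
theorem mem_normalizedPacket_of_map_mem {x : PacketAlgebra p k} (hx : φ x ∈ normalizedPacket p k') :
    x ∈ normalizedPacket p k := by
  obtain ⟨r, hr⟩ := exists_leftInverse_packetAlgHom p k k' φ σ hφ
  have hinj : Function.Injective (φ.restrictScalars ℤ_[p]) := Function.LeftInverse.injective hr
  rw [mem_normalizedPacket_iff_isIntegral] at hx ⊢
  exact (isIntegral_algHom_iff (φ.restrictScalars ℤ_[p]) hinj).mp hx

/-- `φ x ∈ (R'_I)^∼ ↔ x ∈ (R_I)^∼` (with w5-d036's `map_mem_normalizedPacket`).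
[cite: Mochizuki2012, IUTchIV Prop. 1.1 p. 9] -/
theorem map_mem_normalizedPacket_iff {x : PacketAlgebra p k} :
    φ x ∈ normalizedPacket p k' ↔ x ∈ normalizedPacket p k :=
  ⟨mem_normalizedPacket_of_map_mem p k k' φ σ hφ, map_mem_normalizedPacket p k k' φ⟩

/-! ## §3 Ascent of movers -/

/-- **ASCENT OF MAXIMAL-ORDER MOVERS.**  If factorwise `ℚ_p`-linear ISOMETRIES `g_i` of the `k_i` move a point
`z ∈ (R_I)^∼` out of `(R_I)^∼` (`(⊗ g_i) z ∉ (R_I)^∼`), then along field maps `σ_i : k_i → k'_i` there are factorwise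
`ℚ_p`-linear ISOMETRIES `G_i` of the `k'_i` EXTENDING the `g_i` (`G_i(σ_i a) = σ_i(g_i a)`; §1, the `σ_i` being
isometric) with `φ z ∈ (R'_I)^∼` and `(⊗ G_i)(φ z) ∉ (R'_I)^∼` (else `φ((⊗ g_i) z) = (⊗ G_i)(φ z)` would be integral,
and `φ` reflects integrality). [cite: Mochizuki2012, IUTchIV Prop. 1.1 p. 9] [cite: NeukirchANT1999, Ch. II Thm. (4.8)] -/
theorem exists_isometries_mover_of_mover (g : ∀ i, k i ≃ₗ[ℚ_[p]] k i) (hg : ∀ i x, ‖g i x‖ = ‖x‖)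
    {z : PacketAlgebra p k} (hz : z ∈ normalizedPacket p k)
    (hmv : PiTensorProduct.congr g z ∉ normalizedPacket p k) :
    ∃ G : ∀ i, k' i ≃ₗ[ℚ_[p]] k' i, (∀ i y, ‖G i y‖ = ‖y‖) ∧ (∀ i a, G i (σ i a) = σ i (g i a)) ∧
      φ z ∈ normalizedPacket p k' ∧ PiTensorProduct.congr G (φ z) ∉ normalizedPacket p k' := by
  have hG : ∀ i, ∃ G : k' i ≃ₗ[ℚ_[p]] k' i, (∀ a, G (σ i a) = σ i (g i a)) ∧ ∀ y, ‖G y‖ = ‖y‖ := by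
    intro i
    haveI : FiniteDimensional ℚ_[p] (k' i) := FiniteDimensional.of_locallyCompactSpace ℚ_[p]
    exact MoverAscent.exists_isometry_extension (σ i).toLinearMap (norm_map_algHom (σ i)) (g i) (hg i)
  choose G hGσ hGn using hG
  refine ⟨G, hGn, hGσ, map_mem_normalizedPacket p k k' φ hz, fun hmem => hmv ?_⟩
  rw [← map_congr_eq_congr_map p k k' φ σ hφ g G hGσ z] at hmem
  exact mem_normalizedPacket_of_map_mem p k k' φ σ hφ hmem

end Packets

/-! ## §3′ The two-slot form `![G, 1]` over one field embedding `k₀ → K` -/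

section Pair

variable (p : ℕ) [Fact p.Prime]
variable {k₀ : Type} [NontriviallyNormedField k₀] [NormedAlgebra ℚ_[p] k₀] [IsUltrametricDist k₀] [ProperSpace k₀]
variable {K : Type} [NontriviallyNormedField K] [NormedAlgebra ℚ_[p] K] [IsUltrametricDist K] [ProperSpace K]

/-- **Two-slot ascent, in the shape of `WildCubicIsometryMover.exists_isometry_maxOrder_mover`.**  If over `k₀` an
isometry `g` and a point `z ∈ (R_I)^∼` of `k₀ ⊗_{ℚ_p} k₀` satisfy `(g ⊗ 1) z ∉ (R_I)^∼`, then over ANY `p`-adic field `K`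
receiving `k₀` (`σ : k₀ →ₐ[ℚ_p] K`) there are a `ℚ_p`-linear ISOMETRY `G` of `K` extending `g` (so `G` maps `𝒪_K` and
every `𝔪_K^n` onto themselves) and a point `z' ∈ (R_I)^∼` of `K ⊗_{ℚ_p} K` with `(G ⊗ 1) z' ∉ (R_I)^∼` (`z' = (σ ⊗ σ) z`).
[cite: Mochizuki2012, IUTchIV Prop. 1.1 p. 9] [cite: NeukirchANT1999, Ch. II Thm. (4.8), (5.5)] -/
theorem exists_isometry_mover_pair_of_subfield (σ : k₀ →ₐ[ℚ_[p]] K) (g : k₀ ≃ₗ[ℚ_[p]] k₀)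
    (hg : ∀ x, ‖g x‖ = ‖x‖) {z : PacketAlgebra p (fun _ : Fin 2 => k₀)}
    (hz : z ∈ (normalizedPacket p (fun _ : Fin 2 => k₀) : Set (PacketAlgebra p (fun _ : Fin 2 => k₀))))
    (hmv : (PiTensorProduct.congr (![g, LinearEquiv.refl ℚ_[p] k₀] : ∀ _ : Fin 2, k₀ ≃ₗ[ℚ_[p]] k₀) :
        PacketAlgebra p (fun _ : Fin 2 => k₀) ≃ₗ[ℚ_[p]] PacketAlgebra p (fun _ : Fin 2 => k₀)) z ∉
      (normalizedPacket p (fun _ : Fin 2 => k₀) : Set (PacketAlgebra p (fun _ : Fin 2 => k₀)))) :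
    ∃ G : K ≃ₗ[ℚ_[p]] K, (∀ y, ‖G y‖ = ‖y‖) ∧ (∀ r : ℝ, G '' closedBall (0 : K) r = closedBall 0 r) ∧
      (∀ a, G (σ a) = σ (g a)) ∧
      ∃ z' : PacketAlgebra p (fun _ : Fin 2 => K),
        z' ∈ (normalizedPacket p (fun _ : Fin 2 => K) : Set (PacketAlgebra p (fun _ : Fin 2 => K))) ∧
          (PiTensorProduct.congr (![G, LinearEquiv.refl ℚ_[p] K] : ∀ _ : Fin 2, K ≃ₗ[ℚ_[p]] K) :
              PacketAlgebra p (fun _ : Fin 2 => K) ≃ₗ[ℚ_[p]] PacketAlgebra p (fun _ : Fin 2 => K)) z' ∉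
            (normalizedPacket p (fun _ : Fin 2 => K) : Set (PacketAlgebra p (fun _ : Fin 2 => K))) := by
  obtain ⟨φ, hφ⟩ := exists_packetAlgHom_of_algHom p (fun _ : Fin 2 => k₀) (fun _ : Fin 2 => K) (fun _ => σ)
  haveI : FiniteDimensional ℚ_[p] K := FiniteDimensional.of_locallyCompactSpace ℚ_[p]
  obtain ⟨G, hGσ, hGn⟩ := MoverAscent.exists_isometry_extension σ.toLinearMap (norm_map_algHom σ) g hg
  refine ⟨G, hGn, image_closedBall_eq_of_norm_map_eq p G hGn, hGσ, φ z,
    map_mem_normalizedPacket p _ _ φ hz, fun hmem => hmv ?_⟩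
  have hint : ∀ (i : Fin 2) (a : k₀), (![G, LinearEquiv.refl ℚ_[p] K] : ∀ _ : Fin 2, K ≃ₗ[ℚ_[p]] K) i (σ a) =
      σ ((![g, LinearEquiv.refl ℚ_[p] k₀] : ∀ _ : Fin 2, k₀ ≃ₗ[ℚ_[p]] k₀) i a) := by
    intro i a
    fin_cases i
    · exact hGσ a
    · rfl
  have h := map_congr_eq_congr_map p (fun _ : Fin 2 => k₀) (fun _ : Fin 2 => K) φ (fun _ => σ) hφ
    (![g, LinearEquiv.refl ℚ_[p] k₀]) (![G, LinearEquiv.refl ℚ_[p] K]) hint z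
  rw [← h] at hmem
  exact mem_normalizedPacket_of_map_mem p (fun _ : Fin 2 => k₀) (fun _ : Fin 2 => K) φ (fun _ => σ) hφ hmem

end Pair

end Literature.IUT.LogVolume

end
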